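import Summits.BirchSwinnertonDyer.BirchSwinnertonDyer.Theorems.ManinLocalTwoThreeParabolicHeckePerm
import HarnessLib

/-!
# `heckeU` on degree-`0` cocycles does not depend on the system of Hecke representatives (σ2 of MEMO-es §25.6)

Summit `BirchSwinnertonDyer`, route `ManinLocalTwoThree` (cell bsd-f2-manin), deciding crux C2 `ManinOddAtFour`
(stmt-BirchSwinnertonDyer-22967), registered line `kato_shift_two` v6, open stub 3 `stub_cThreeImageResidual` (the `C₃`-image
residual; planner memo MEMO-es §25 «Bass–Serre / Wiles-L.2.5 descent»).  §25.6 σ2 asks for the REPRESENTATIVE-INDEPENDENCE of the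
tree's Hecke operator `HidaCohomology.heckeU 0 N R hp` (defined with the FIXED representatives `heckeRep p i`): the auxiliary
cocycles `u ∘ Ad(g)` of the descent (`g` = Atkin–Lehner `W_t`, lower unipotents) are Hecke generalised eigenvectors because
`Ad(g)` carries the standard system of representatives of `Γ₀(N) diag(1,p) Γ₀(N)` to ANOTHER system `β′_i = δ_i β_{π(i)}`
(`δ_i ∈ Γ₀(N)`, `π` a permutation), and on homomorphisms the Hecke sum computed with any such system is the same:

**`heckeU_zero_apply_eq_sum_of_reps`**: if `β′_i γ = γ″_i β′_{σ′(i)}` with `γ″_i ∈ Γ₀(N)` for all `i`, then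
`(heckeU 0 N R hp u)(γ) = Σ_i u(γ″_i)` for every degree-`0` cocycle `u` — the uniqueness of the coset index
(`heckePerm_eq_of_candidate`) gives `γ′_{π i} = δ_i⁻¹ γ″_i δ_{σ′ i}` and `σ_γ ∘ π = π ∘ σ′`, and the correction
`Σ_i (u(δ_{σ′ i}) − u(δ_i))` telescopes because `σ′` is a bijection.  No new definitions; nothing about BSD or Manin's conjecture
is proved here.

References: G. Shimura, *Introduction to the arithmetic theory of automorphic functions* (1971) §8.3, (8.3.2) and the remark
after it (independence of the choice of representatives) [cite: Shimura1971, §8.3 (8.3.2)]; cell memo HOME/MEMO-es.md §25.6 σ2.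
-/

set_option autoImplicit false
set_option linter.dupNamespace false

open scoped MatrixGroups

open CongruenceSubgroup Matrix.SpecialLinearGroup Literature.NumberTheory.EllipticCurves.ModularForms
  Literature.NumberTheory.EllipticCurves.ModularForms.HidaCohomology

namespace Summit.BirchSwinnertonDyer.BirchSwinnertonDyer.Theorems.ManinLocalTwoThree

section RepIndependence

variable {N p : ℕ} [NeZero p] (hp : p.Prime) {R : Type*} [CommRing R]

omit [NeZero p] in
/-- **Permutation data for a second system of representatives** `β′_i = δ_i β_{π i}`: if `β′_i γ = γ″_i β′_{σ′ i}` then the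
tree's data at the index `π i` are `σ_γ(π i) = π(σ′ i)` and `γ′_{π i} = δ_i⁻¹ γ″_i δ_{σ′ i}`. [cite: Shimura1971, §8.3 (8.3.2)] -/
theorem heckePermElt_eq_of_reps (γ : Gamma0 N) (π : HeckeIdx N p ≃ HeckeIdx N p) (δ : HeckeIdx N p → Gamma0 N)
    (σ' : HeckeIdx N p → HeckeIdx N p) (γ'' : HeckeIdx N p → Gamma0 N)
    (h : ∀ i, gmat (δ i) * heckeRep p (π i).1 * gmat γ = gmat (γ'' i) * (gmat (δ (σ' i)) * heckeRep p (π (σ' i)).1))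
    (i : HeckeIdx N p) :
    heckePerm hp γ (π i) = π (σ' i) ∧ heckePermElt hp γ (π i) = (δ i)⁻¹ * γ'' i * δ (σ' i) := by
  have hcand : (((δ i)⁻¹ * γ'' i * δ (σ' i) : Gamma0 N) : SL(2, ℤ)) * heckeRep p (π (σ' i)).1 =
      heckeRep p (π i).1 * ((γ : SL(2, ℤ)) : Matrix (Fin 2) (Fin 2) ℤ) := by
    have h' := h i
    rw [Subgroup.coe_mul, Subgroup.coe_mul, Subgroup.coe_inv, Matrix.SpecialLinearGroup.coe_mul,
      Matrix.SpecialLinearGroup.coe_mul]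
    calc ((((δ i : Gamma0 N) : SL(2, ℤ))⁻¹ : SL(2, ℤ)) : Matrix (Fin 2) (Fin 2) ℤ) * gmat (γ'' i) * gmat (δ (σ' i)) *
          heckeRep p (π (σ' i)).1
        = ((((δ i : Gamma0 N) : SL(2, ℤ))⁻¹ : SL(2, ℤ)) : Matrix (Fin 2) (Fin 2) ℤ) *
          (gmat (γ'' i) * (gmat (δ (σ' i)) * heckeRep p (π (σ' i)).1)) := by simp only [Matrix.mul_assoc]
      _ = ((((δ i : Gamma0 N) : SL(2, ℤ))⁻¹ : SL(2, ℤ)) : Matrix (Fin 2) (Fin 2) ℤ) *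
          (gmat (δ i) * heckeRep p (π i).1 * gmat γ) := by rw [← h']
      _ = heckeRep p (π i).1 * gmat γ := by
          rw [← Matrix.mul_assoc, ← Matrix.mul_assoc, gmat, coe_inv_mul_coe, Matrix.one_mul]
  obtain ⟨hidx, helt⟩ := heckePerm_eq_of_candidate hp γ (π i) (π (σ' i)).1 _ hcand
  exact ⟨Subtype.ext hidx, Subtype.ext helt⟩

/-- **`heckeU 0` is representative-independent** (MEMO-es §25.6 σ2): for a degree-`0` cocycle `u`, `γ ∈ Γ₀(N)`, and any
second system of representatives `β′_i = δ_i β_{π i}` with data `β′_i γ = γ″_i β′_{σ′ i}` (`γ″_i ∈ Γ₀(N)`):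
`(T_p u)(γ) = Σ_i u(γ″_i)`. [cite: Shimura1971, §8.3 (8.3.2)] -/
theorem heckeU_zero_apply_eq_sum_of_reps {u : Gamma0 N → Fin 1 → R} (hu : u ∈ cocycles 0 N R) (γ : Gamma0 N)
    (π : HeckeIdx N p ≃ HeckeIdx N p) (δ : HeckeIdx N p → Gamma0 N) (σ' : HeckeIdx N p → HeckeIdx N p)
    (γ'' : HeckeIdx N p → Gamma0 N)
    (h : ∀ i, gmat (δ i) * heckeRep p (π i).1 * gmat γ = gmat (γ'' i) * (gmat (δ (σ' i)) * heckeRep p (π (σ' i)).1)) :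
    heckeU 0 N R hp u γ = ∑ i : HeckeIdx N p, u (γ'' i) := by
  classical
  have hdata := heckePermElt_eq_of_reps hp γ π δ σ' γ'' h
  -- `σ′ = π⁻¹ ∘ σ_γ ∘ π` is a bijection
  have hσ' : ∀ i, σ' i = π.symm (heckePermEquiv hp γ (π i)) := by
    intro i
    rw [heckePermEquiv_apply, (hdata i).1, Equiv.symm_apply_apply]
  let e : HeckeIdx N p ≃ HeckeIdx N p := (π.trans (heckePermEquiv hp γ)).trans π.symm
  have he : ∀ i, e i = σ' i := fun i ↦ by rw [hσ' i]; rfl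
  rw [heckeU_apply]
  simp only [act_zero_eq_id, LinearMap.id_apply]
  -- reindex the tree's sum by `π`
  rw [← Equiv.sum_comp π (fun j ↦ u (heckePermElt hp γ j))]
  simp only [fun i ↦ (hdata i).2, cocycle_zero_mul hu, cocycle_zero_inv hu]
  rw [Finset.sum_add_distrib, Finset.sum_add_distrib]
  -- the correction terms cancel: `Σ u(δ (σ′ i)) = Σ u(δ i)`
  have hcorr : ∑ i, u (δ (σ' i)) = ∑ i, u (δ i) := by
    rw [show (fun i ↦ u (δ (σ' i))) = fun i ↦ u (δ (e i)) from funext fun i ↦ by rw [he]]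
    exact Equiv.sum_comp e (fun i ↦ u (δ i))
  rw [hcorr, Finset.sum_neg_distrib]
  abel

end RepIndependence

end Summit.BirchSwinnertonDyer.BirchSwinnertonDyer.Theorems.ManinLocalTwoThree
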